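import Mathlib
import Literature.Analysis.FunctionSpaces.ContDiffHolderLocalization
import Literature.Analysis.FunctionSpaces.ContDiffHolderComposition
import Literature.Analysis.FunctionSpaces.ContDiffHolderOne
import Literature.Analysis.FunctionSpaces.ContDiffHolderFDerivCLM
import HarnessLib

/-!
# Elliptic bootstrapping for `J`-holomorphic curves in Hölder classes: local Hölder classes

For the Hölder bootstrapping of `J`-holomorphic curves
(`Literature/Geometry/Symplectic/JHolomorphicRegularityHolder.lean`; McDuff–Salamon 2012,
Thm. B.4.1) smoothness is a LOCAL matter, while the tree's Hölder classes
`MemContDiffHolder k r` (`C^{k,r}_b(ℂ, Y)`: `C^k`, bounded derivatives, `r`-Hölder `k`-th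
derivative; `Literature/Analysis/FunctionSpaces`) are global. We use throughout the phrase

  `∃ W, MemContDiffHolder k r W ∧ W =ᶠ[𝓝 z₀] g`     ("`g` is of class `C^{k,r}` near `z₀`")

and record here its calculus, inherited from the global classes: extraction of real bounds,
lowering the order, directional derivatives, pointwise products `z ↦ P z (w z)`, differences,
post-composition with smooth maps, and local smoothness.

## References

* D. McDuff, D. Salamon, *J-holomorphic curves and symplectic topology*, 2nd ed. (2012),
  App. B.4, Thm. B.4.1. [McDuffSalamon2012]
* D. Gilbarg, N. S. Trudinger, *Elliptic Partial Differential Equations of Second Order* (2001),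
  §4.1. [GilbargTrudinger2001]
-/

noncomputable section

open Set Metric Filter Function
open scoped Topology NNReal ContDiff

namespace Literature.Geometry.Symplectic

open Literature.Analysis.FunctionSpaces

universe u

section Bounds

variable {Y : Type*} [NormedAddCommGroup Y] [NormedSpace ℝ Y] {r : ℝ≥0}

omit [NormedSpace ℝ Y] in
/-- A real Hölder-type bound gives `HolderWith`. [folklore] -/
theorem holderWith_of_norm_sub_le {X : Type*} [NormedAddCommGroup X] {f : X → Y} {K : ℝ}
    (hK : 0 ≤ K) (h : ∀ x y, ‖f x - f y‖ ≤ K * ‖x - y‖ ^ (r : ℝ)) :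
    HolderWith K.toNNReal r f :=
  holderWith_of_dist_le fun x y => by
    rw [dist_eq_norm, dist_eq_norm, Real.coe_toNNReal K hK]
    exact h x y

omit [NormedSpace ℝ Y] in
/-- `HolderWith` gives a real Hölder-type bound. [folklore] -/
theorem norm_sub_le_of_holderWith {X : Type*} [NormedAddCommGroup X] {f : X → Y} {C : ℝ≥0}
    (h : HolderWith C r f) (x y : X) : ‖f x - f y‖ ≤ C * ‖x - y‖ ^ (r : ℝ) := by
  have h1 := h.dist_le x y
  rwa [dist_eq_norm, dist_eq_norm] at h1

/-- **Real bounds from `C^{0,r}_b` membership**: one constant `a ≥ 0` with `‖g‖ ≤ a` and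
`‖g z - g z'‖ ≤ a ‖z - z'‖ ^ r`. [folklore] -/
theorem bounds_of_memContDiffHolder_zero {X : Type*} [NormedAddCommGroup X] [NormedSpace ℝ X]
    {g : X → Y} (hg : MemContDiffHolder 0 r g) :
    ∃ a : ℝ, 0 ≤ a ∧ (∀ z, ‖g z‖ ≤ a) ∧ ∀ z z', ‖g z - g z'‖ ≤ a * ‖z - z'‖ ^ (r : ℝ) := by
  obtain ⟨a₀, ha₀⟩ := hg.exists_norm_le
  obtain ⟨C, hC⟩ := memHolder_iteratedFDeriv_zero_iff.1 hg.memHolder_iteratedFDeriv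
  refine ⟨max a₀ C, le_max_of_le_right C.2, fun z => (ha₀ z).trans (le_max_left _ _),
    fun z z' => (norm_sub_le_of_holderWith hC z z').trans ?_⟩
  gcongr
  exact le_max_right _ _

/-- **Real bounds from `C^{1,r}_b` membership** (`r ≤ 1`): one constant `a ≥ 0` with `‖g‖ ≤ a`,
`‖Dg‖ ≤ a`, `‖Dg z - Dg z'‖ ≤ a ‖z - z'‖ ^ r` and `‖g z - g z'‖ ≤ a ‖z - z'‖ ^ r`. [folklore] -/
theorem bounds_of_memContDiffHolder_one {X : Type*} [NormedAddCommGroup X] [NormedSpace ℝ X]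
    (hr : r ≤ 1) {g : X → Y} (hg : MemContDiffHolder 1 r g) :
    ∃ a : ℝ, 0 ≤ a ∧ (∀ z, ‖g z‖ ≤ a) ∧ (∀ z, ‖fderiv ℝ g z‖ ≤ a) ∧
      (∀ z z', ‖fderiv ℝ g z - fderiv ℝ g z'‖ ≤ a * ‖z - z'‖ ^ (r : ℝ)) ∧
      ∀ z z', ‖g z - g z'‖ ≤ a * ‖z - z'‖ ^ (r : ℝ) := by
  obtain ⟨a, ha, h0, h1⟩ := bounds_of_memContDiffHolder_zero (hg.of_succ hr)
  obtain ⟨b, hb, h2, h3⟩ := bounds_of_memContDiffHolder_zero hg.fderiv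
  refine ⟨max a b, le_max_of_le_left ha, fun z => (h0 z).trans (le_max_left _ _),
    fun z => (h2 z).trans (le_max_right _ _), fun z z' => (h3 z z').trans ?_,
    fun z z' => (h1 z z').trans ?_⟩
  · gcongr
    exact le_max_right _ _
  · gcongr
    exact le_max_left _ _

end Bounds

section Loc

variable {Y : Type*} [NormedAddCommGroup Y] [NormedSpace ℝ Y] {r : ℝ≥0} {z₀ : ℂ}

/-- Lowering the order of a local Hölder class by one (`r ≤ 1`). [folklore] -/
theorem locHolder_of_succ (hr : r ≤ 1) {k : ℕ} {g : ℂ → Y}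
    (h : ∃ W, MemContDiffHolder (k + 1) r W ∧ W =ᶠ[𝓝 z₀] g) :
    ∃ W, MemContDiffHolder k r W ∧ W =ᶠ[𝓝 z₀] g := by
  obtain ⟨W, hW, hWg⟩ := h
  exact ⟨W, hW.of_succ hr, hWg⟩

/-- Lowering the order of a local Hölder class (`r ≤ 1`). [folklore] -/
theorem locHolder_of_le (hr : r ≤ 1) {j k : ℕ} (hjk : j ≤ k) {g : ℂ → Y}
    (h : ∃ W, MemContDiffHolder k r W ∧ W =ᶠ[𝓝 z₀] g) :
    ∃ W, MemContDiffHolder j r W ∧ W =ᶠ[𝓝 z₀] g := by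
  induction k, hjk using Nat.le_induction with
  | base => exact h
  | succ k _ ih => exact ih (locHolder_of_succ hr h)

/-- Local smoothness: a map of local class `C^{k,r}` near `z₀` is `C^k` near `z₀`. [folklore] -/
theorem eventually_contDiffAt_of_locHolder {k : ℕ} {g : ℂ → Y}
    (h : ∃ W, MemContDiffHolder k r W ∧ W =ᶠ[𝓝 z₀] g) :
    ∀ᶠ z in 𝓝 z₀, ContDiffAt ℝ k g z := by
  obtain ⟨W, hW, hWg⟩ := h
  filter_upwards [hWg.eventuallyEq_nhds] with z hz
  exact hW.contDiff.contDiffAt.congr_of_eventuallyEq hz.symm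

/-- **Directional derivatives**: if `g` is of local class `C^{k+1,r}` near `z₀` then
`z ↦ Dg(z) e` is of local class `C^{k,r}` near `z₀`. [folklore] -/
theorem locHolder_fderiv_apply {k : ℕ} {g : ℂ → Y}
    (h : ∃ W, MemContDiffHolder (k + 1) r W ∧ W =ᶠ[𝓝 z₀] g) (e : ℂ) :
    ∃ W, MemContDiffHolder k r W ∧ W =ᶠ[𝓝 z₀] fun z => fderiv ℝ g z e := by
  obtain ⟨W, hW, hWg⟩ := h
  refine ⟨fun z => fderiv ℝ W z e, ?_, ?_⟩
  · exact hW.fderiv.clm_comp (ContinuousLinearMap.apply ℝ Y e)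
  · filter_upwards [hWg.eventuallyEq_nhds] with z hz
    rw [hz.fderiv_eq]

/-- The zero map is of every local class. [folklore] -/
theorem locHolder_zero (k : ℕ) :
    ∃ W : ℂ → Y, MemContDiffHolder k r W ∧ W =ᶠ[𝓝 z₀] fun _ => 0 :=
  ⟨0, memContDiffHolder_zero_fun, Eventually.of_forall fun _ => rfl⟩

/-- **Differences** of maps of local class `C^{k,r}`. [folklore] -/
theorem locHolder_sub {k : ℕ} {g₁ g₂ : ℂ → Y}
    (h₁ : ∃ W, MemContDiffHolder k r W ∧ W =ᶠ[𝓝 z₀] g₁)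
    (h₂ : ∃ W, MemContDiffHolder k r W ∧ W =ᶠ[𝓝 z₀] g₂) :
    ∃ W, MemContDiffHolder k r W ∧ W =ᶠ[𝓝 z₀] fun z => g₁ z - g₂ z := by
  obtain ⟨W₁, hW₁, hW₁g⟩ := h₁
  obtain ⟨W₂, hW₂, hW₂g⟩ := h₂
  refine ⟨W₁ - W₂, by simpa [sub_eq_add_neg] using hW₁.add hW₂.neg, ?_⟩
  filter_upwards [hW₁g, hW₂g] with z h1 h2
  simp [h1, h2]

/-- **Sums** of maps of local class `C^{k,r}`. [folklore] -/
theorem locHolder_add {k : ℕ} {g₁ g₂ : ℂ → Y}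
    (h₁ : ∃ W, MemContDiffHolder k r W ∧ W =ᶠ[𝓝 z₀] g₁)
    (h₂ : ∃ W, MemContDiffHolder k r W ∧ W =ᶠ[𝓝 z₀] g₂) :
    ∃ W, MemContDiffHolder k r W ∧ W =ᶠ[𝓝 z₀] fun z => g₁ z + g₂ z := by
  obtain ⟨W₁, hW₁, hW₁g⟩ := h₁
  obtain ⟨W₂, hW₂, hW₂g⟩ := h₂
  refine ⟨W₁ + W₂, hW₁.add hW₂, ?_⟩
  filter_upwards [hW₁g, hW₂g] with z h1 h2
  simp [h1, h2]

end Loc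

section Products

variable {Y Z : Type} [NormedAddCommGroup Y] [NormedSpace ℝ Y] [NormedAddCommGroup Z]
  [NormedSpace ℝ Z] {r : ℝ≥0} {z₀ : ℂ}

/-- **Pointwise products** `z ↦ P z (w z)` of maps of local class `C^{k,r}` (`r ≤ 1`; the Leibniz
rule in `C^{k,r}_b`, `MemContDiffHolder.bilinear`). [folklore] -/
theorem locHolder_clm_apply (hr : r ≤ 1) {k : ℕ} {P : ℂ → Y →L[ℝ] Z} {w : ℂ → Y}
    (hP : ∃ W, MemContDiffHolder k r W ∧ W =ᶠ[𝓝 z₀] P)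
    (hw : ∃ W, MemContDiffHolder k r W ∧ W =ᶠ[𝓝 z₀] w) :
    ∃ W, MemContDiffHolder k r W ∧ W =ᶠ[𝓝 z₀] fun z => P z (w z) := by
  obtain ⟨W₁, hW₁, hW₁g⟩ := hP
  obtain ⟨W₂, hW₂, hW₂g⟩ := hw
  refine ⟨fun z => W₁ z (W₂ z),
    hW₁.bilinear hr (ContinuousLinearMap.id ℝ (Y →L[ℝ] Z)) hW₂, ?_⟩
  filter_upwards [hW₁g, hW₂g] with z h1 h2
  simp [h1, h2]

/-- **Post-composition with a smooth map** (`Y` finite-dimensional; the Nemytskii property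
`MemContDiffHolder.comp_left`). [folklore] -/
theorem locHolder_comp_left [FiniteDimensional ℝ Y] (hr : r ≤ 1) {k : ℕ} {φ : Y → Z}
    (hφ : ContDiff ℝ ∞ φ) {u : ℂ → Y} (hu : ∃ W, MemContDiffHolder k r W ∧ W =ᶠ[𝓝 z₀] u) :
    ∃ W, MemContDiffHolder k r W ∧ W =ᶠ[𝓝 z₀] fun z => φ (u z) := by
  obtain ⟨W, hW, hWg⟩ := hu
  refine ⟨φ ∘ W, hW.comp_left hr (hφ.of_le (by exact_mod_cast le_top)), ?_⟩
  filter_upwards [hWg] with z hz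
  simp [hz]

end Products

end Literature.Geometry.Symplectic
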